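import Mathlib

/-!
# T4PairBirth — the two-channel tower arithmetic behind the pair law of `W_C ∘ avgⁿ` (cell T4, row T4-NE1ii-BIRTH)

Cell typing for the near-miss cell `pub-balaban` (Bałaban YM₄ UV-stability reconstruction), node O3b/O3c of `t4/T4-DAG.md`,
row T4-NE1ii-BIRTH; companion of the EST record `t4/T4-EST-NE1iiBirth.md` v1 (unit `b2b-balaban-pv05-g6`).  NOTHING in
this file is printed by Bałaban: the manuscripts [Balaban1985Averaging] (CMP 98, (14)/(15) p. 19) define the block average
of a lattice gauge field and assert no law for its second derivatives in two fine bonds.  What the record derives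
([analysis] at flat background, second-order Baker–Campbell–Hausdorff inside each logarithm of (15), reproduced exactly by
two independent toy engines) is a RECURSION over averaging levels for the mixed second-order response `m n` of a unit
observable to two fine-bond perturbations:

  `m (n+1) ≤ ρ · m n + β · p n`,   `p n ≤ P · σⁿ`,

— a born `su(2)` element propagates LINEARLY with the first-order per-level factor `ρ` of its carrier (`ρ ∈ [L^{−d}, L^{1−d}]`),
and at every level a new one is BORN from the two spread first-order images, whose product has size `P σⁿ` (`σ` = product
of the two first-order factors, so `σ < ρ`).  This file proves ONLY the elementary consequences of that recursion which the
record's §5/§7 use, over `ℝ`, with every constant explicit: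

* §1 `twoChannel_le` — the exact two-term majorant `m n ≤ (m 0 + βP/(ρ−σ))·ρⁿ − (βP/(ρ−σ))·σⁿ` (the "two-channel closed
  form" `a·ρⁿ + b·σⁿ` measured by both engines), and `twoChannel_le'` dropping the negative term: FIRST-ORDER RATE `ρ` PER
  LEVEL for co-read pairs (class (I) of the record), never the product rate.
* §2ter `twoChannel_le_var` / `delayedBirth_le_var` (v3) — VARIABLE COEFFICIENTS: at a curved (visited) background the
  composition of averaging steps is the second-order chain rule `∂ₛ∂ₜZₙ₊₁ = DΨₙ[∂ₛ∂ₜZₙ] + D²Ψₙ[∂ₛZₙ, ∂ₜZₙ]` (record v1.3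
  §5bis), so the level-`n` propagation factor `ρf n` (a norm of `DΨₙ`) and birth coefficient `βf n` (a norm of `D²Ψₙ`,
  whose one-step kernel is the all-order law B1″ of record v1.3 §3ter with majorant `m(Θ, κ)` of §3quater) depend on the
  level; dominated by constants `ρf n ≤ ρ`, `βf n ≤ β` on nonnegative responses they give the SAME bounds as §1/§2.
* §2 `delayedBirth_le` — if nothing is born during the first `n′` levels (never-co-read pairs: the configuration rectangle
  persists, kernel `T4JointDressing.rectangle_iterFrom`), the bound carries the extra factor `σ^{n′}`: the separated law
  `θ₁^{n−n′} θₓ^{…}`-type exponent bookkeeping of `T4JointDressing.LoopPairOscBoundSep` (class (II)).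
* §2bis `sepExponent_le` / `sepExponent_le'` / `sepExponent_uniform` (v2) — with `ρ = θ`, `σ = θ²` and birth at level
  `n′`: `m (n′+j) ≤ (βP/(θ(1−θ)))·θ^{n′+j}·θ^{n′}` — THE ROW'S TOWER RULE "mixed ≍ C(L)·θ₁^{n+n′}" in the exponent
  currency of `T4JointDressing.LoopPairOscBoundSep av dom C₂ θ₁ θₓ` with `θₓ = θ₁` (a first-order rate over all levels
  times one factor `θ₁` per level of separation), and its uniform `θₓ = 1` shadow.
* §3 booking arithmetic of `t4/T4-DAG.md` §8 Q17 (a) at `d = 4`, `θ₁ = L^{1−d} = L^{−3}`: per level the sup/Taylor route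
  multiplies by `L⁴·L^{−3} = L ≥ 2` (the geometric series is NOT summable), the second-moment route by `L⁴·L^{−6} = L^{−2}
  ≤ 1/4` (summable, sum `≤ 4/3`).

Readings: the hypotheses `hm`, `hp` below are CELL TYPING of a toy-located mechanism, NOT printed statements and NOT
proved for Bałaban's average on any domain of configurations (the curved-background one-step law is open: record §8 (1),
GAPS G-pv05g6-2 → narrowed G-pv05g6-4; the curved ONE-STEP law is record v1.2 §3bis, not kernel-typed).
v3 = v2 + §2ter (`twoChannel_le_var`, `delayedBirth_le_var`: level-dependent coefficients dominated by constants — the curved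
composition of record v1.3 §5bis; unit `b2b-balaban-pv05-g7`); v2 theorems byte-identical.
v2 = v1.1 + §2bis (`sepExponent_le`, `sepExponent_le'`, `sepExponent_uniform`: the row's tower rule in the exponent
currency of `T4JointDressing.LoopPairOscBoundSep` with `θₓ = θ₁`, record §5 B3 (ii)); v1/v1.1 theorems byte-identical.
v1.1 = v1 + DOCFIX (XREAD pv28-g5 remarks R1/R2: `delayedBirth_le` hypothesis wording, `supRoute_not_summable` hazard wording); statements
and proofs byte-identical.  value = kernel arithmetic, NOT summit progress; NOT continuum, NOT Clay.

References: T. Bałaban, Averaging operations for lattice gauge theories, Commun. Math. Phys. 98 (1985) 17–51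
[Balaban1985Averaging] ((14), (15) p. 19 — context only).  Cell records: `t4/T4-EST-NE1iiBirth.md` v1 (9f83a5ff9a01e3eb) → v1.2 (44919522e6045aaa; §3bis curved one-step law, §7 booking AGREED),
`t4/T4-RUNG-O3c1.md` v1.0 §3.3, `t4/T4-RUNG-O3c1-B2.md` v1.2.1 §9.1; record v1.3 (§3ter all-order one-step law B1″, §3quater domain
version, §5bis curved composition).
-/

namespace Literature.MathematicalPhysics.QuantumFieldTheory.Balaban1983to89.T4PairBirth

open Finset

/-! ## §1 The two-channel tower: linear propagation at rate `ρ` plus a geometric source of ratio `σ` -/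

/-- THE TWO-CHANNEL MAJORANT (exact two-term form).  If `m (n+1) ≤ ρ·m n + β·p n` with `ρ ≥ 0`, `β ≥ 0`, and the source
obeys `p n ≤ P·σⁿ` with `σ ≠ ρ`, then `m n ≤ (m 0 + βP/(ρ−σ))·ρⁿ − (βP/(ρ−σ))·σⁿ` for every `n` (with EQUALITY throughout
when the hypotheses are equalities: the engines' closed forms `a·ρⁿ + b·σⁿ`).  No sign assumption on `σ`, `P`, `m`.
[folklore] -/
theorem twoChannel_le {m p : ℕ → ℝ} {ρ σ β P : ℝ} (hρ : 0 ≤ ρ) (hβ : 0 ≤ β) (hne : σ ≠ ρ)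
    (hm : ∀ n, m (n + 1) ≤ ρ * m n + β * p n) (hp : ∀ n, p n ≤ P * σ ^ n) (n : ℕ) :
    m n ≤ (m 0 + β * P / (ρ - σ)) * ρ ^ n - β * P / (ρ - σ) * σ ^ n := by
  have hρσ : ρ - σ ≠ 0 := sub_ne_zero.mpr (Ne.symm hne)
  induction n with
  | zero => simp
  | succ n ih =>
    have h1 : m (n + 1) ≤ ρ * m n + β * p n := hm n
    have h2 : β * p n ≤ β * (P * σ ^ n) := mul_le_mul_of_nonneg_left (hp n) hβ
    have h3 : ρ * m n ≤ ρ * ((m 0 + β * P / (ρ - σ)) * ρ ^ n - β * P / (ρ - σ) * σ ^ n) :=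
      mul_le_mul_of_nonneg_left ih hρ
    -- the key identity: −c·ρ·σⁿ + βP·σⁿ = −c·σ^{n+1} for c = βP/(ρ−σ)
    have key : ρ * ((m 0 + β * P / (ρ - σ)) * ρ ^ n - β * P / (ρ - σ) * σ ^ n) + β * (P * σ ^ n)
        = (m 0 + β * P / (ρ - σ)) * ρ ^ (n + 1) - β * P / (ρ - σ) * σ ^ (n + 1) := by
      field_simp
      ring
    linarith [h1, h2, h3, key.le, key.ge]

/-- CLASS (I) — FIRST-ORDER RATE PER LEVEL: with `0 ≤ σ < ρ`, `0 ≤ P` the negative term is dropped and the co-read pair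
response is bounded by a constant times `ρⁿ`, `ρ` the first-order factor of the carrier — NOT by the product rate `σⁿ`.
[folklore] -/
theorem twoChannel_le' {m p : ℕ → ℝ} {ρ σ β P : ℝ} (hβ : 0 ≤ β) (hP : 0 ≤ P) (hσ : 0 ≤ σ) (hσρ : σ < ρ)
    (hm : ∀ n, m (n + 1) ≤ ρ * m n + β * p n) (hp : ∀ n, p n ≤ P * σ ^ n) (n : ℕ) :
    m n ≤ (m 0 + β * P / (ρ - σ)) * ρ ^ n := by
  have hρ : 0 ≤ ρ := hσ.trans hσρ.le
  have h := twoChannel_le hρ hβ (ne_of_lt hσρ) hm hp n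
  have hc : 0 ≤ β * P / (ρ - σ) * σ ^ n :=
    mul_nonneg (div_nonneg (mul_nonneg hβ hP) (sub_nonneg.mpr hσρ.le)) (pow_nonneg hσ n)
  linarith

/-- The instance the record uses: `ρ = θ` (first-order factor), `σ = θ²` (product of two first-order factors), `0 < θ < 1`:
`m n ≤ (m 0 + βP/(θ(1−θ)))·θⁿ`. [folklore] -/
theorem coread_firstOrderRate {m p : ℕ → ℝ} {θ β P : ℝ} (hβ : 0 ≤ β) (hP : 0 ≤ P) (hθ : 0 < θ) (hθ1 : θ < 1)
    (hm : ∀ n, m (n + 1) ≤ θ * m n + β * p n) (hp : ∀ n, p n ≤ P * (θ ^ 2) ^ n) (n : ℕ) :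
    m n ≤ (m 0 + β * P / (θ * (1 - θ))) * θ ^ n := by
  have hσρ : θ ^ 2 < θ := by nlinarith
  have h := twoChannel_le' hβ hP (sq_nonneg θ) hσρ hm hp n
  have hden : θ - θ ^ 2 = θ * (1 - θ) := by ring
  rw [hden] at h
  exact h

/-! ## §2 Delayed birth: never-co-read pairs (the rectangle persists for `n′` levels) -/

/-- CLASS (II) / THE SEPARATED LAW.  If the mixed response vanishes AT level `n′` (`m n′ = 0` — only the value at the
birth level is used; in the record's setting it vanishes for all `k ≤ n′`: no common contour word ⇒ no birth, record §4,
kernel `T4JointDressing.rectangle_iterFrom`) and from level `n′` on the two-channel recursion holds with source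
`p k ≤ P·σᵏ`, then for every `j`,
`m (n′ + j) ≤ (βP·σ^{n′}/(ρ−σ))·ρʲ` — the first `n′` levels are paid at the PRODUCT rate `σ`, the remaining `j` at the
first-order rate `ρ`. [folklore] -/
theorem delayedBirth_le {m p : ℕ → ℝ} {ρ σ β P : ℝ} {n' : ℕ} (hβ : 0 ≤ β) (hP : 0 ≤ P) (hσ : 0 ≤ σ) (hσρ : σ < ρ)
    (hzero : m n' = 0) (hm : ∀ k, n' ≤ k → m (k + 1) ≤ ρ * m k + β * p k) (hp : ∀ k, p k ≤ P * σ ^ k) (j : ℕ) :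
    m (n' + j) ≤ β * (P * σ ^ n') / (ρ - σ) * ρ ^ j := by
  -- shift the tower to start at level n'
  set m' : ℕ → ℝ := fun i => m (n' + i) with hm'def
  set p' : ℕ → ℝ := fun i => p (n' + i) with hp'def
  have hm' : ∀ i, m' (i + 1) ≤ ρ * m' i + β * p' i := by
    intro i
    have := hm (n' + i) (Nat.le_add_right _ _)
    simpa [hm'def, hp'def, Nat.add_assoc] using this
  have hp' : ∀ i, p' i ≤ P * σ ^ n' * σ ^ i := by
    intro i
    have := hp (n' + i)
    simpa [hp'def, pow_add, mul_assoc] using this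
  have h := twoChannel_le' (P := P * σ ^ n') hβ (mul_nonneg hP (pow_nonneg hσ _)) hσ hσρ hm' hp' j
  have h0 : m' 0 = 0 := by simp [hm'def, hzero]
  rw [h0, zero_add] at h
  simpa [hm'def] using h

/-! ## §2bis The separated-shape exponent: `θ₁ⁿ · θ₁^{n′}` (the tower rule of the DAG row, in the currency of
`T4JointDressing.LoopPairOscBoundSep av dom C₂ θ₁ θₓ` with `θₓ = θ₁`) -/

/-- THE ROW'S TOWER RULE ("composed n times the separation law mixed ≍ C(L)·θ₁^{n+n′} follows", T4-DAG §5 row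
T4-NE1ii-BIRTH), scalar form: first-order propagation at rate `θ` (`0 < θ < 1`), sources bounded by the PRODUCT of two
first-order responses (`p k ≤ P·(θ²)ᵏ`), no birth up to level `n′` (`m n′ = 0`).  Then at every later level `n = n′ + j`
the mixed response is at most `(β·P / (θ·(1 − θ))) · θⁿ · θ^{n′}` — a first-order rate `θ` over ALL `n` levels times one
extra factor `θ` per level of separation: exactly the exponent of the separated pair shape
`T4JointDressing.LoopPairOscBoundSep … θ₁ θₓ` with `θₓ = θ₁` (record `t4/T4-EST-NE1iiBirth.md` §5 B3 (ii); the
co-read class is `n′ = 0`, `coread_firstOrderRate`).  The constant is explicit and blows up only as `θ → 0` or `θ → 1`.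
[folklore] -/
theorem sepExponent_le {m p : ℕ → ℝ} {θ β P : ℝ} {n' : ℕ} (hβ : 0 ≤ β) (hP : 0 ≤ P) (hθ : 0 < θ) (hθ1 : θ < 1)
    (hzero : m n' = 0) (hm : ∀ k, n' ≤ k → m (k + 1) ≤ θ * m k + β * p k) (hp : ∀ k, p k ≤ P * (θ ^ 2) ^ k)
    (j : ℕ) : m (n' + j) ≤ β * P / (θ * (1 - θ)) * θ ^ (n' + j) * θ ^ n' := by
  have hσρ : θ ^ 2 < θ := by nlinarith
  have h := delayedBirth_le (ρ := θ) (σ := θ ^ 2) hβ hP (by positivity) hσρ hzero hm hp j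
  have hden : θ - θ ^ 2 = θ * (1 - θ) := by ring
  have hkey : β * (P * (θ ^ 2) ^ n') / (θ - θ ^ 2) * θ ^ j = β * P / (θ * (1 - θ)) * θ ^ (n' + j) * θ ^ n' := by
    rw [hden]
    have hθ0 : θ ≠ 0 := hθ.ne'
    have h1θ : (1 - θ) ≠ 0 := by linarith
    field_simp
    ring
  linarith [hkey ▸ h]

/-- The same bound with the separation factor written as ONE exponent, `θ^{n + n′}` with `n = n′ + j` the total number of
levels (the DAG row's wording). [folklore] -/
theorem sepExponent_le' {m p : ℕ → ℝ} {θ β P : ℝ} {n' : ℕ} (hβ : 0 ≤ β) (hP : 0 ≤ P) (hθ : 0 < θ) (hθ1 : θ < 1)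
    (hzero : m n' = 0) (hm : ∀ k, n' ≤ k → m (k + 1) ≤ θ * m k + β * p k) (hp : ∀ k, p k ≤ P * (θ ^ 2) ^ k)
    (j : ℕ) : m (n' + j) ≤ β * P / (θ * (1 - θ)) * θ ^ ((n' + j) + n') := by
  have h := sepExponent_le hβ hP hθ hθ1 hzero hm hp j
  simpa [pow_add, mul_assoc] using h

/-- UNIFORM CONSEQUENCE (what survives WITHOUT separation information): since `θ^{n′} ≤ 1`, every pair — co-read or
separated — obeys the first-order-rate bound `(β·P/(θ(1−θ)))·θⁿ` (`LoopPairOscBoundSep.of_pair`-type reading with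
`θₓ = 1`). [folklore] -/
theorem sepExponent_uniform {m p : ℕ → ℝ} {θ β P : ℝ} {n' : ℕ} (hβ : 0 ≤ β) (hP : 0 ≤ P) (hθ : 0 < θ) (hθ1 : θ < 1)
    (hzero : m n' = 0) (hm : ∀ k, n' ≤ k → m (k + 1) ≤ θ * m k + β * p k) (hp : ∀ k, p k ≤ P * (θ ^ 2) ^ k)
    (j : ℕ) : m (n' + j) ≤ β * P / (θ * (1 - θ)) * θ ^ (n' + j) := by
  have h := sepExponent_le hβ hP hθ hθ1 hzero hm hp j
  have hC : 0 ≤ β * P / (θ * (1 - θ)) * θ ^ (n' + j) := by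
    have : 0 < θ * (1 - θ) := by nlinarith
    positivity
  have hpow : θ ^ n' ≤ 1 := pow_le_one₀ hθ.le hθ1.le
  calc m (n' + j) ≤ β * P / (θ * (1 - θ)) * θ ^ (n' + j) * θ ^ n' := h
    _ ≤ β * P / (θ * (1 - θ)) * θ ^ (n' + j) * 1 := by gcongr
    _ = β * P / (θ * (1 - θ)) * θ ^ (n' + j) := by ring

/-! ## §2ter Variable coefficients: the curved composition (second-order chain rule), dominated by constants -/

/-- VARIABLE-COEFFICIENT TWO-CHANNEL MAJORANT (the curved composition, record v1.3 §5bis).  Along a tower of averaging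
steps at a curved background, `Zₙ₊₁ = Ψₙ(Zₙ)` in logarithmic coordinates gives EXACTLY
`∂ₛ∂ₜZₙ₊₁ = DΨₙ[∂ₛ∂ₜZₙ] + D²Ψₙ[∂ₛZₙ, ∂ₜZₙ]`, hence for the sizes `m (n+1) ≤ ρf n · m n + βf n · p n` with
LEVEL-DEPENDENT `ρf n` (operator norm of `DΨₙ` in the chosen seminorm) and `βf n` (norm of the bilinear `D²Ψₙ`; one-step
kernel = the all-order law B1″, majorant `m(Θₙ, κₙ)`).  If `ρf n ≤ ρ`, `βf n ≤ β` and the responses are nonnegative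
(they are norms), the constant-coefficient bound of `twoChannel_le'` holds verbatim: `m n ≤ (m 0 + βP/(ρ−σ))·ρⁿ`.
Cell typing: the domination `ρf n ≤ ρ < 1` uniformly in the level is NOT printed and NOT proved here (it is the averaged
step contraction of row T4-NE1a-STEP on Bałaban's domains); this lemma is the bookkeeping only. [folklore] -/
theorem twoChannel_le_var {m p ρf βf : ℕ → ℝ} {ρ σ β P : ℝ} (hβ : 0 ≤ β) (hP : 0 ≤ P) (hσ : 0 ≤ σ) (hσρ : σ < ρ)
    (hρf : ∀ n, ρf n ≤ ρ) (hβf : ∀ n, βf n ≤ β) (hm0 : ∀ n, 0 ≤ m n) (hp0 : ∀ n, 0 ≤ p n)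
    (hm : ∀ n, m (n + 1) ≤ ρf n * m n + βf n * p n) (hp : ∀ n, p n ≤ P * σ ^ n) (n : ℕ) :
    m n ≤ (m 0 + β * P / (ρ - σ)) * ρ ^ n := by
  have hm' : ∀ k, m (k + 1) ≤ ρ * m k + β * p k := by
    intro k
    have h1 := hm k
    have h2 : ρf k * m k ≤ ρ * m k := mul_le_mul_of_nonneg_right (hρf k) (hm0 k)
    have h3 : βf k * p k ≤ β * p k := mul_le_mul_of_nonneg_right (hβf k) (hp0 k)
    linarith
  exact twoChannel_le' hβ hP hσ hσρ hm' hp n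

/-- VARIABLE-COEFFICIENT DELAYED BIRTH (class (II) at a curved background): as `delayedBirth_le`, with level-dependent
coefficients from the birth level `n′` on, dominated by constants `ρf k ≤ ρ`, `βf k ≤ β` on nonnegative responses:
`m (n′ + j) ≤ (βP·σ^{n′}/(ρ−σ))·ρʲ`. [folklore] -/
theorem delayedBirth_le_var {m p ρf βf : ℕ → ℝ} {ρ σ β P : ℝ} {n' : ℕ} (hβ : 0 ≤ β) (hP : 0 ≤ P) (hσ : 0 ≤ σ)
    (hσρ : σ < ρ) (hρf : ∀ k, ρf k ≤ ρ) (hβf : ∀ k, βf k ≤ β) (hm0 : ∀ k, 0 ≤ m k) (hp0 : ∀ k, 0 ≤ p k)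
    (hzero : m n' = 0) (hm : ∀ k, n' ≤ k → m (k + 1) ≤ ρf k * m k + βf k * p k) (hp : ∀ k, p k ≤ P * σ ^ k)
    (j : ℕ) : m (n' + j) ≤ β * (P * σ ^ n') / (ρ - σ) * ρ ^ j := by
  have hm' : ∀ k, n' ≤ k → m (k + 1) ≤ ρ * m k + β * p k := by
    intro k hk
    have h1 := hm k hk
    have h2 : ρf k * m k ≤ ρ * m k := mul_le_mul_of_nonneg_right (hρf k) (hm0 k)
    have h3 : βf k * p k ≤ β * p k := mul_le_mul_of_nonneg_right (hβf k) (hp0 k)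
    linarith
  exact delayedBirth_le hβ hP hσ hσρ hzero hm' hp j

/-! ## §3 Booking arithmetic of Q17 (a) at `d = 4`, `θ₁ = L^{−3}` -/

/-- SUP/TAYLOR ROUTE: per level the co-read pair channel loses `θ₁ = L^{−3}` and gains `L⁴` positions; the ratio is
`L⁴·L^{−3} = L`. [folklore] -/
theorem supRatio_eq (L : ℝ) (hL : L ≠ 0) : L ^ 4 * (L ^ 3)⁻¹ = L := by
  field_simp

/-- … and for `L ≥ 1` the resulting geometric series `Σₙ (L⁴·L^{−3})ⁿ` is NOT summable — the divergence behind the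
CONDITIONAL hazard H-O3b-pair of `t4/T4-DAG.md` §8 Q17 (a) (a design constraint on any sup-norm booking of the centred
co-read channel summed over birth levels; it stands against no current record: `t4/T4-EST-NE1iiBirth.md` v1.2 §7,
`t4/T4-EST-O3Eiiib.md` v2 §4bis). [folklore] -/
theorem supRoute_not_summable (L : ℝ) (hL : 1 ≤ L) : ¬ Summable (fun n : ℕ => (L ^ 4 * (L ^ 3)⁻¹) ^ n) := by
  have hL0 : L ≠ 0 := by positivity
  rw [supRatio_eq L hL0, summable_geometric_iff_norm_lt_one, Real.norm_eq_abs, abs_of_nonneg (by linarith)]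
  exact not_lt.mpr hL

/-- SECOND-MOMENT ROUTE: the variance carries `θ₁²` per level against the same `L⁴` positions; the ratio is
`L⁴·(L^{−3})² = L^{−2}`. [folklore] -/
theorem momentRatio_eq (L : ℝ) (hL : L ≠ 0) : L ^ 4 * ((L ^ 3)⁻¹) ^ 2 = (L ^ 2)⁻¹ := by
  field_simp

/-- … which is `≤ 1/4` for `L ≥ 2`, so the geometric series is summable with sum `≤ 4/3`. [folklore] -/
theorem momentRoute_summable (L : ℝ) (hL : 2 ≤ L) :
    Summable (fun n : ℕ => (L ^ 4 * ((L ^ 3)⁻¹) ^ 2) ^ n) ∧ ∑' n : ℕ, (L ^ 4 * ((L ^ 3)⁻¹) ^ 2) ^ n ≤ 4 / 3 := by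
  have hL0 : L ≠ 0 := by positivity
  rw [momentRatio_eq L hL0]
  have hq0 : 0 ≤ (L ^ 2)⁻¹ := by positivity
  have hL2 : 4 ≤ L ^ 2 := by nlinarith
  have hq : (L ^ 2)⁻¹ ≤ 1 / 4 := by
    rw [inv_eq_one_div]
    exact one_div_le_one_div_of_le (by norm_num) hL2
  have hq1 : (L ^ 2)⁻¹ < 1 := by linarith
  refine ⟨summable_geometric_of_lt_one hq0 hq1, ?_⟩
  rw [tsum_geometric_of_lt_one hq0 hq1]
  have hpos : 0 < 1 - (L ^ 2)⁻¹ := by linarith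
  have hx0 : 0 ≤ (1 - (L ^ 2)⁻¹)⁻¹ := inv_nonneg.mpr hpos.le
  have hmul : (1 - (L ^ 2)⁻¹)⁻¹ * (1 - (L ^ 2)⁻¹) = 1 := inv_mul_cancel₀ hpos.ne'
  nlinarith [hmul, hq, hx0, mul_nonneg hx0 (sub_nonneg.mpr hq)]

end Literature.MathematicalPhysics.QuantumFieldTheory.Balaban1983to89.T4PairBirth
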